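import Literature.IUT.HodgeArakelov.BadPrimeGaussianMonoidsProofs3

/-!
# [IUTchII] Cor 3.5 (ii) "⥤" / Remark 3.6.1: Galois compatibility of the restriction, restriction typed OUT OF
# THE MONOID — proof companion of `BadPrimeGaussianMonoids.lean`

S. Mochizuki, *Inter-universal Teichmüller theory II*, §3, kurims Dec-2020 manuscript, Cor 3.5 (ii) p. 95 ("the
compatibility of the action of `G_v(M^Θ_*▶)_{|t|}` on the factor labeled `|t|` … with the inclusions
`G_v(M^Θ_*) ↪ Π_{v▶}(M^Θ_*▶)` determined by the various choices of the `D^δ_{t,μ_-}`"; "each `Ψ_ξ(M^Θ_*)` is equipped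
with a natural action by `G_v(M^Θ_*▶)_{⟨F_l^⋇⟩}`"), Remark 3.6.1 p. 101 ("involving the monoids `∞Ψ` [i.e., not just
the monoids `Ψ`!]") [cite: Mochizuki2012, Cor 3.5 (ii) p.95]. Claim key DISPUTED (D-0012). PROOF-ONLY companion
(abc-iut cell, layer L6, seat abc-iut-w5-d031): a GENERALISATION (not a correction — holder abc-iut-w4-d004,
STATUS 00:24:42Z (C)) of the Galois section of `BadPrimeGaussianMonoidsProofs3.lean` (abc-iut-w4-d004), whose three
statements are typed with the restriction out of a commutative GROUP `H`; here the SAME statements are proved with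
the source an arbitrary commutative MONOID `A`, so that they ALSO instantiate at the typed theta monoids `↥Ψ^ι_env`,
`↥∞Ψ^ι_env` with the monoid-sourced restrictions of `BadPrimeGaussianMonoidsProofs4.lean` (abc-iut-w4-d004, the
shape adopted here) and `BadPrimeGaussianMonoidsInftyRestrictionProofs.lean`, and for the WHOLE source monoid
(`mrange`-form, the `∞Ψ` case of Remark 3.6.1). NO definition, NO `Prop` fact; the `G_v`-action DATA (`conj`,
the sections `s_t`, `β`, equivariance `hr`, conjugate synchronization `hsync`) remain HYPOTHESES exactly as in
Proofs3. Nothing here asserts a disputed claim or takes a side on [IUTchIII] Cor 3.12; typed ≠ proved ≠ endorsed.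
-/

namespace Literature.IUT.HodgeArakelov

namespace BadPrimeGaussianMonoids

universe u v w

section GaloisMonoid

variable {A : Type u} [CommMonoid A] {T : Type v} {M : Type w} [CommMonoid M]
  {G : Type*} [Group G] {P : Type*} [Group P]
  (conj : P →* MulAut A) (s : T → (G →* P)) (β : G →* MulAut M) (r : T → (A →* M))

/-- **IUTchII:Cor3.5(ii)** (kurims p.95) "⥤", monoid-sourced: if each restriction `r_t : A →* Ψ_cns,t` is equivariant
along the inclusion `s_t : G_v ↪ Π_X` through which it was restricted, and the resulting `G_v`-actions AGREE on a
submonoid `S` (conjugate synchronization), then on `S` the product of the restrictions intertwines the action through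
any one `s_{t₀}` with the DIAGONAL action on the labeled copies. [cite: Mochizuki2012, Cor 3.5 (ii) p.95] -/
theorem pi_conj_eq_piIso' (hr : ∀ t g x, r t (conj (s t g) x) = β g (r t x)) (S : Submonoid A)
    (hsync : ∀ g t t', ∀ x ∈ S, conj (s t g) x = conj (s t' g) x) (t₀ : T) (g : G) {x : A}
    (hx : x ∈ S) : MonoidHom.pi r (conj (s t₀ g) x) = piIso T (β g) (MonoidHom.pi r x) := by
  funext t
  rw [MonoidHom.pi_apply, hsync g t₀ t x hx, hr]
  rfl

/-- **IUTchII:Cor3.5(ii)** (kurims p.95) "each `Ψ_ξ(M^Θ_*)` is equipped with a natural action by `G_v(M^Θ_*▶)_{⟨F_l^⋇⟩}`",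
monoid-sourced: the IMAGE of a synchronized, stable submonoid `S` under restriction is stable under the diagonal
action. [cite: Mochizuki2012, Cor 3.5 (ii) p.95] -/
theorem map_pi_diagonalStable' (hr : ∀ t g x, r t (conj (s t g) x) = β g (r t x)) (S : Submonoid A)
    (hsync : ∀ g t t', ∀ x ∈ S, conj (s t g) x = conj (s t' g) x)
    (hstab : ∀ g t, ∀ x ∈ S, conj (s t g) x ∈ S) (t₀ : T) (g : G) :
    (S.map (MonoidHom.pi r)).map (piIso T (β g)).toMonoidHom = S.map (MonoidHom.pi r) := by
  apply le_antisymm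
  · rintro _ ⟨_, ⟨x, hx, rfl⟩, rfl⟩
    exact ⟨conj (s t₀ g) x, hstab g t₀ x hx, pi_conj_eq_piIso' conj s β r hr S hsync t₀ g hx⟩
  · rintro _ ⟨x, hx, rfl⟩
    refine ⟨MonoidHom.pi r (conj (s t₀ g⁻¹) x), ⟨_, hstab g⁻¹ t₀ x hx, rfl⟩, ?_⟩
    rw [pi_conj_eq_piIso' conj s β r hr S hsync t₀ g⁻¹ hx, map_inv]
    exact (piIso T (β g)).apply_symm_apply _

/-- **IUTchII:Cor3.5(ii)** / **Rmk3.6.1** (kurims p.95, p.101), monoid-sourced and for the WHOLE source monoid (the case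
`A = ∞Ψ^ι_env` of Remark 3.6.1 "involving the monoids `∞Ψ`"): under equivariance and synchronization on all of `A`,
the printed `∞Ψ_ξ` — the image `mrange (MonoidHom.pi r)` — is stable under the diagonal `G_v`-action.
[cite: Mochizuki2012, Rmk 3.6.1 p.101] -/
theorem mrange_pi_diagonalStable (hr : ∀ t g x, r t (conj (s t g) x) = β g (r t x))
    (hsync : ∀ g t t' x, conj (s t g) x = conj (s t' g) x) (t₀ : T) (g : G) :
    (MonoidHom.mrange (MonoidHom.pi r)).map (piIso T (β g)).toMonoidHom = MonoidHom.mrange (MonoidHom.pi r) := by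
  rw [MonoidHom.mrange_eq_map]
  exact map_pi_diagonalStable' conj s β r hr ⊤ (fun g t t' x _ => hsync g t t' x)
    (fun _ _ _ _ => Submonoid.mem_top _) t₀ g

/-- **IUTchII:Rmk3.6.1** (kurims p.101) "the «Galois compatibility» … corresponds precisely to the «Galois
functoriality»", monoid-sourced: any restriction ISOMORPHISM `e : S ⥲ S'` whose underlying map is the restriction
(Proofs4 `exists_restrictionIso'`, or `exists_unique_inftyRestrictionIso_inftyThetaMonoid` at the `∞`-level) is
`G_v`-equivariant for the action through `s_{t₀}` on `S` and the diagonal action on `S'`.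
[cite: Mochizuki2012, Rmk 3.6.1 p.101] -/
theorem restrictionIso_equivariant' (hr : ∀ t g x, r t (conj (s t g) x) = β g (r t x)) (S : Submonoid A)
    (hsync : ∀ g t t', ∀ x ∈ S, conj (s t g) x = conj (s t' g) x)
    (hstab : ∀ g t, ∀ x ∈ S, conj (s t g) x ∈ S) {S' : Submonoid (T → M)} (e : S ≃* S')
    (he : ∀ x : S, ((e x : S') : T → M) = MonoidHom.pi r x) (t₀ : T) (g : G) (x : S) :
    ((e ⟨conj (s t₀ g) x, hstab g t₀ x x.2⟩ : S') : T → M) = piIso T (β g) (e x : T → M) := by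
  rw [he, he]
  exact pi_conj_eq_piIso' conj s β r hr S hsync t₀ g x.2

/-- **IUTchII:Rmk3.6.1** (kurims p.101), the same for an isomorphism out of the WHOLE source monoid (`A = ↥Ψ^ι_env` or
`↥∞Ψ^ι_env`, `e : A ⥲ Ψ_ξ` resp. `A ⥲ ∞Ψ_ξ` with underlying map the restriction): `e` intertwines `conj ∘ s_{t₀}` with
the diagonal action. [cite: Mochizuki2012, Rmk 3.6.1 p.101] -/
theorem sourceIso_equivariant (hr : ∀ t g x, r t (conj (s t g) x) = β g (r t x))
    (hsync : ∀ g t t' x, conj (s t g) x = conj (s t' g) x) {S' : Submonoid (T → M)} (e : A ≃* S')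
    (he : ∀ x : A, ((e x : S') : T → M) = MonoidHom.pi r x) (t₀ : T) (g : G) (x : A) :
    ((e (conj (s t₀ g) x) : S') : T → M) = piIso T (β g) (e x : T → M) := by
  rw [he, he]
  exact pi_conj_eq_piIso' conj s β r hr ⊤ (fun g t t' x _ => hsync g t t' x) t₀ g (Submonoid.mem_top x)

end GaloisMonoid

end BadPrimeGaussianMonoids

end Literature.IUT.HodgeArakelov
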